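import Summits.QuantumFields.YangMills.Theorems.LangevinControlUVOSLegsFromFemtoAndGapDefs
import Literature.MathematicalPhysics.QuantumFieldTheory.Balaban1983to89.MassGapFunctionalInequalities
import Literature.MathematicalPhysics.QuantumLattice.EuclideanAction
import HarnessLib

/-!
# Route `BalabanLadder`, crux `IR` (stmt-QuantumFields-19354): vocabulary of the COLD-PRESSURE PINCER

Route-posited objects (D-0016 `<Route><Crux>Defs` file) of the crux-idea card `Cruxes/IR/Ideas/ym19354-5-cold-pressure-pincer.md` (seat `ym-cruxidea-19354-5` gen 2; sketch of record
`Sketch-g2.lean` sha16 `d0296864a2f25cb8`, evidence #49 on stmt-QuantumFields-19354), landed as helper modules per the route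
owner's LANDABLE-NOW list R19 (8) «cold-pressure seams … as idle work» (ym-beyond-p2 g24) by ★ym-osasm-p1 g7, `--supports
stmt-QuantumFields-19354` (helper; no registered stub of 19354 is claimed — the slot of record is `af-pincer-T`).
The proofs live in `BalabanLadderIRColdPressurePincer` (pincer ∕ rate seam ∕ `IR_of_cp` ∕ strong-coupling rung ∕ the
simply-connected repair) and `IR/Negative/ColdPressureOnsetFalseOfLightFlux` (the π₁-exposure).

CONTENT (card §Mechanism).  The owner's picked parallel line `af-pincer` proves `IR` from a per-β strong-mixing onset (stub I)
and asymptotic freedom below the onset (stub X) through a pincer and a rate seam.  This card re-types stub I in the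
reflection-positivity ∕ transfer-matrix currency — PERIODIC FREE ENERGIES ONLY (no boundary datum, no observable, no DLR∕TV
criterion) — through the tree's Literature schema `Balaban1983to89.Sufficient.ColdPressureBound` (= verbatim the antecedent of
the landed `TraceNormColdPressure.abs_latticeConnectedCorr_le_of_coldPressure`):

* §0 `ColdPressureAt ρ β ξ` (per-β cold pressure with correlation length `ξ`), `cpSet`, the intrinsic COLD-PRESSURE LENGTH
  `cpLength ρ β = sInf (cpSet ρ β)` with its `sInf` API (`cpLength_spec`, `cpLength_le`) and `ColdPressureAt.mono`.
* §1 the two stub STATEMENTS of the pincer: `ColdPressureOnset` (I_cp) and `AFToColdPressure` (X_cp, af-pincer's X with the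
  cold-pressure length as the scale).
* §2 the repair vocabulary: `IRsc` ∕ `IRnsc` (the crux `IR` restricted to simply-connected ∕ non-simply-connected structure
  groups — restrictions recorded as line statements, NOT facts) and `ColdPressureOnsetSC` (I_cp for `π₁(G) = 1`).

NOTHING here is asserted and nothing is a literature fact.  `ColdPressureOnset` AS TYPED OVER ALL SIMPLE `G` is refuted
modulo `LightFluxMode SO(3)` in `IR/Negative/ColdPressureOnsetFalseOfLightFlux` (the reason for the gen-3 light-code currency
`BalabanLadderIRLightCode*`).  HONEST FRAMING: vocabulary of a conditional reduction; not a gap claim.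

Refs: card (tree `Cruxes/IR/Ideas/ym19354-5-cold-pressure-pincer.md`); Osterwalder–Seiler, Ann. Phys. 110 (1978) §3
(transfer matrix, trace excess); Kotecký–Preiss (strong-coupling rung, via `Balaban1983to89.Missing`); 't Hooft, Nucl. Phys.
B153 (1979) (flux sectors).
-/

set_option autoImplicit false

noncomputable section

open Filter Topology MeasureTheory
open scoped SchwartzMap
open Literature.MathematicalPhysics.QuantumFieldTheory Literature.MathematicalPhysics.QuantumLattice
open Summit.QuantumFields.YangMills.Cruxes.OSLegsFromFemtoAndGap.DlrCollarTransfer (GapInUnits LowerBounds Q2)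
open Literature.MathematicalPhysics.QuantumFieldTheory.Balaban1983to89.Sufficient (ColdPressureBound)

namespace Summit.QuantumFields.YangMills.Cruxes.IR.ColdPressurePincer

/-! ## §0 The intrinsic scale: per-β cold pressure and the cold-pressure length -/

section Defs

variable {G : Type} [Group G] [TopologicalSpace G] [IsTopologicalGroup G] [CompactSpace G]
  [MeasurableSpace G] [BorelSpace G]

/-- **Per-β cold pressure with correlation length `ξ`** (lattice units): there are `C₀ ≥ 0` and a spatial threshold
`S₁` such that every torus of half-side `S ≥ S₁` obeys the tree schema `ColdPressureBound ρ β S (1/ξ) C₀`, i.e.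
`traceExcess ρ β (2S+1) (m+2) ≤ C₀ (2S+1)³ e^{−(m+2)/ξ}` on the cold range `S + 1 ≤ 2(m+2)`.  One partition-function
inequality per cold shape: no observable, no boundary datum, no unit map. [folklore] -/
def ColdPressureAt {N : ℕ} (ρ : G →* Matrix (Fin N) (Fin N) ℂ) (β : ℝ) (ξ : ℕ) : Prop :=
  ∃ (C₀ : ℝ) (S₁ : ℕ), 0 ≤ C₀ ∧ ∀ S : ℕ, S₁ ≤ S → ColdPressureBound ρ β S (1 / (ξ : ℝ)) C₀

/-- The set of admissible cold-pressure lengths at `(ρ, β)` (`ξ = 0` excluded: junk rate `1/0 = 0`). -/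
def cpSet {N : ℕ} (ρ : G →* Matrix (Fin N) (Fin N) ℂ) (β : ℝ) : Set ℕ :=
  {ξ : ℕ | 1 ≤ ξ ∧ ColdPressureAt ρ β ξ}

/-- **The cold-pressure length** `ξ⋆(ρ, β)`: the LEAST admissible cold-pressure length (`sInf`; `= 0` when none) —
the line's intrinsic scale, defined from tree objects for every `(G, ρ, β)`. -/
def cpLength {N : ℕ} (ρ : G →* Matrix (Fin N) (Fin N) ℂ) (β : ℝ) : ℕ :=
  sInf (cpSet ρ β)

/-- If some cold-pressure length is admissible, `cpLength` is admissible and `≥ 1` (`Nat.sInf_mem`). -/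
theorem cpLength_spec {N : ℕ} (ρ : G →* Matrix (Fin N) (Fin N) ℂ) (β : ℝ) (h : (cpSet ρ β).Nonempty) :
    1 ≤ cpLength ρ β ∧ ColdPressureAt ρ β (cpLength ρ β) :=
  Nat.sInf_mem h

/-- `cpLength` is the least admissible length (`Nat.sInf_le`). -/
theorem cpLength_le {N : ℕ} (ρ : G →* Matrix (Fin N) (Fin N) ℂ) (β : ℝ) {ξ : ℕ} (hξ : 1 ≤ ξ)
    (h : ColdPressureAt ρ β ξ) : cpLength ρ β ≤ ξ :=
  Nat.sInf_le ⟨hξ, h⟩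

/-- A longer correlation length is a weaker bound. -/
theorem ColdPressureAt.mono {N : ℕ} {ρ : G →* Matrix (Fin N) (Fin N) ℂ} {β : ℝ} {ξ ξ' : ℕ}
    (h : ColdPressureAt ρ β ξ) (hξ : 1 ≤ ξ) (hle : ξ ≤ ξ') : ColdPressureAt ρ β ξ' := by
  obtain ⟨C₀, S₁, hC₀, hP⟩ := h
  refine ⟨C₀, S₁, hC₀, fun S hS m hm => (hP S hS m hm).trans ?_⟩
  have hV : 0 ≤ C₀ * ((2 * S + 1 : ℕ) : ℝ) ^ 3 := by positivity
  refine mul_le_mul_of_nonneg_left (Real.exp_le_exp.2 ?_) hV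
  have hξpos : (0 : ℝ) < (ξ : ℝ) := by exact_mod_cast hξ
  have hle' : (ξ : ℝ) ≤ (ξ' : ℝ) := by exact_mod_cast hle
  have h01 : 1 / (ξ' : ℝ) ≤ 1 / (ξ : ℝ) := one_div_le_one_div_of_le hξpos hle'
  have hm0 : (0 : ℝ) ≤ ((m + 2 : ℕ) : ℝ) := Nat.cast_nonneg _
  nlinarith

end Defs

/-! ## §1 The two stub STATEMENTS of the cold-pressure pincer -/

/-- **stub I_cp — COLD-PRESSURE ONSET (the IR side at an intrinsic scale, periodic free energies only).**  For every
compact simple `G` and every `r`: a threshold `β₂` such that at every `β ≥ β₂` SOME cold-pressure length `ξ ≥ 1` is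
admissible.  No unit map, no `LowerBounds`, no uniformity of `(ξ, C₀, S₁)` in `β`, no boundary condition other than
periodic.  Content: "the cold torus does not feel its period" at each fixed weak coupling — massive, local
thermodynamics of 4D lattice Yang–Mills (the cold-range form of the pub-balaban audit's S-T′, per β).  Simplicity of `G`
is load-bearing (U(1): photon gas, `log(1+X) ∼ V/t³`, no admissible `ξ`). -/
def ColdPressureOnset : Prop :=
  ∀ (G : Type) [Group G] [TopologicalSpace G] [IsTopologicalGroup G] [CompactSpace G],
    IsCompactSimpleLieGroup G → letI : MeasurableSpace G := borel G; haveI : BorelSpace G := ⟨rfl⟩;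
    ∀ r : LatticeRep G, ∃ β₂ : ℝ, ∀ β : ℝ, β₂ ≤ β → ∃ ξ : ℕ, 1 ≤ ξ ∧ ColdPressureAt r.ρ β ξ

/-- **stub X_cp — ASYMPTOTIC FREEDOM UP TO THE COLD-PRESSURE LENGTH (the UV side at the same intrinsic scale).**
`af-pincer`'s `AFToOnset` verbatim with `mixOnset r.ρ β n ε ↦ cpLength r.ρ β` (and no admissibility data): for every
positive-time real test function `v` and `η > 0`, a factor `T` and a threshold `β₁` such that for `β ≥ β₁` and every
spacing `s > 0` whose unit `1/s` is at most `ξ⋆(β)/T` lattice sites, `|Q2 G r β L s (Θv) v| ≤ η` on tori of infinitely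
many sizes.  (Vacuous at couplings with no admissible length.) -/
def AFToColdPressure : Prop :=
  ∀ (G : Type) [Group G] [TopologicalSpace G] [IsTopologicalGroup G] [CompactSpace G],
    IsCompactSimpleLieGroup G → letI : MeasurableSpace G := borel G; haveI : BorelSpace G := ⟨rfl⟩;
    ∀ (r : LatticeRep G) (v : 𝓢(EuclideanSpace ℝ (Fin 4), ℝ)),
      tsupport v ⊆ {y : EuclideanSpace ℝ (Fin 4) | 0 < y 0} →
        ∀ η : ℝ, 0 < η → ∃ T β₁ : ℝ, ∀ β : ℝ, β₁ ≤ β → ∀ s : ℝ, 0 < s →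
          T ≤ s * (cpLength r.ρ β : ℝ) →
            ∃ᶠ (L : ℕ) in atTop, |Q2 G r β L s (thetaTest 4 v) v| ≤ η

/-! ## §2 The repair vocabulary: the crux split by `π₁`, and stub I_cp on the simply-connected half -/

/-- `IR` restricted to simply-connected structure groups. -/
def IRsc : Prop :=
  ∀ (G : Type) [Group G] [TopologicalSpace G] [IsTopologicalGroup G] [CompactSpace G],
    IsCompactSimpleLieGroup G → SimplyConnectedSpace G →
    letI : MeasurableSpace G := borel G; haveI : BorelSpace G := ⟨rfl⟩;
    ∀ (r : LatticeRep G) (a : ℝ → ℝ), (∀ β, 0 < a β) → Tendsto a atTop (nhds 0) →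
      LowerBounds G r a → GapInUnits G r a

/-- `IR` restricted to NON-simply-connected structure groups (`SO(3)`, `PSU(N)`, …): the flux-sector half — the crux
restricted, recorded as the piece the periodic free-energy currency does NOT buy. -/
def IRnsc : Prop :=
  ∀ (G : Type) [Group G] [TopologicalSpace G] [IsTopologicalGroup G] [CompactSpace G],
    IsCompactSimpleLieGroup G → ¬ SimplyConnectedSpace G →
    letI : MeasurableSpace G := borel G; haveI : BorelSpace G := ⟨rfl⟩;
    ∀ (r : LatticeRep G) (a : ℝ → ℝ), (∀ β, 0 < a β) → Tendsto a atTop (nhds 0) →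
      LowerBounds G r a → GapInUnits G r a

/-- **stub I_cp^{sc} — cold-pressure onset for SIMPLY-CONNECTED simple `G`** (the repaired stub I of the pincer:
immune to `LightFluxMode` kills, which need `π₁(G) ≠ 1`). -/
def ColdPressureOnsetSC : Prop :=
  ∀ (G : Type) [Group G] [TopologicalSpace G] [IsTopologicalGroup G] [CompactSpace G],
    IsCompactSimpleLieGroup G → SimplyConnectedSpace G →
    letI : MeasurableSpace G := borel G; haveI : BorelSpace G := ⟨rfl⟩;
    ∀ r : LatticeRep G, ∃ β₂ : ℝ, ∀ β : ℝ, β₂ ≤ β → ∃ ξ : ℕ, 1 ≤ ξ ∧ ColdPressureAt r.ρ β ξ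

end Summit.QuantumFields.YangMills.Cruxes.IR.ColdPressurePincer

end
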